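import Literature.NumberTheory.Automorphic.TwistedQuotientIndFunShapiroNatural
import HarnessLib

/-!
# Cohomology of a directed union of lattices: orbit gluing from a per-orbit property

Topic `NumberTheory/Automorphic`; namespace `Literature.NumberTheory.Automorphic.TwistedQuotient`.
Theorems only; no named fact, no instance, no `sorry`.  Continuation of
`TwistedQuotientIndFunShapiroNatural`.

`exists_map_indFunMap_eq_of_directed` there glues, over the finitely many `Γ`-orbits on `𝒢 ⧸ L`,
the per-orbit statement "every class of `H^q(Γ_x, N)` comes from some `H^q(Γ_x, N_i)`" obtained
from a finite-type projective resolution of each stabiliser `Γ_x` OVER THE COEFFICIENT RING `A`.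
Here the gluing is separated from the per-orbit input, which is taken as a hypothesis in its
weakest useful form — **up to a fixed integer multiple `N₀`**:

* `exists_map_indFunMap_eq_nsmul_of_orbits` — if for every representative `x ∈ s` of the orbits
  and every `z ∈ H^q(Γ_x, N)` some `H^q(Γ_x, N_i)` contains a class mapping to `N₀ • z`, then for
  every `z ∈ H^q(Γ, indFun σ_N)` some `H^q(Γ, indFun σ_{N_i})` contains a class mapping to `N₀ • z`
  (`H^q(Γ, indFun σ) ≅ ⊕_{x ∈ s} H^q(Γ_x, N_x)` naturally in `N`,
  `indToOrbitCohomologyNat_pi_bijective`, `indToOrbitCohomologyNat_map_indFunMap`).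

The per-orbit input with `N₀ = 1` holds when `Γ_x` is of type `FP_∞` over `ℤ`
(`Literature.Algebra.Homology.exists_map_eq_of_directed_int`), and with `N₀ = [Γ_x : Γ'_x]` when
only a subgroup `Γ'_x` of finite index is (transfer) — the form in which the finiteness theorem of
Borel–Serre is printed ([BorelSerre1973, §11.1 (c)]: torsion-free arithmetic groups are of type
(FL)); this is the step "`p^t ξ` comes from `H^q(X_U, M̃)`" of [Scholze2015, §V.4, proof of
Thm. V.4.1].

## References

* P. Scholze, *On torsion in the cohomology of locally symmetric varieties*, Ann. of Math. 182
  (2015), §V.4, proof of Thm. V.4.1. [Scholze2015]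
* K. S. Brown, *Cohomology of Groups*, GTM 87, III (6.2), (9.5), VIII (4.6). [Brown1982CohomologyGroups]
* A. Borel, J.-P. Serre, *Corners and arithmetic groups* (1973), §11.1. [BorelSerre1973]
-/

noncomputable section

open CategoryTheory
open scoped Classical
open Literature.Algebra.Homology

universe u

namespace Literature.NumberTheory.Automorphic

namespace TwistedQuotient

variable {A : Type u} [CommRing A] {Γ 𝒢 : Type u} [Group Γ] [Group 𝒢] (ι : Γ →* 𝒢)
  (L : Subgroup 𝒢) {N : Type u} [AddCommGroup N] [Module A N] (σ : Representation A L N)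

variable {ι' : Type*} [Preorder ι'] [IsDirected ι' (· ≤ ·)] [Nonempty ι']
  {Nst : ι' → Type u} [∀ i, AddCommGroup (Nst i)] [∀ i, Module A (Nst i)]
  (σst : ∀ i, Representation A L (Nst i))
  (φ : ∀ i, (σst i).IntertwiningMap σ)
  (t : ∀ ⦃i j⦄, i ≤ j → (σst i).IntertwiningMap (σst j))
  (ht : ∀ ⦃i j⦄ (h : i ≤ j) (v : Nst i), φ j (t h v) = φ i v)

include ht in
/-- **Cohomology of a directed union of lattices, glued from the orbits, up to a multiple.**  Let
`N_i → N` (`i` in a directed set, transition maps `t`) be a directed family of `L`-representations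
over `N`, `s` a finite complete system of representatives of the `Γ`-orbits on `𝒢 ⧸ L`, and
`N₀ ∈ ℕ`.  If for every `x ∈ s` and every class `z` of `H^q(Γ_x, N)` there are `i` and a class of
`H^q(Γ_x, N_i)` mapping to `N₀ • z`, then for every class `z` of `H^q(Γ, indFun σ_N)` there are `i`
and a class of `H^q(Γ, indFun σ_{N_i})` mapping to `N₀ • z`.
[cite: Scholze2015, §V.4 (proof of Thm. V.4.1)] [cite: Brown1982CohomologyGroups, III (6.2)] -/
theorem exists_map_indFunMap_eq_nsmul_of_orbits (s : Finset 𝒢)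
    (hdisj : ∀ x ∈ s, ∀ y ∈ s, (∃ γ : Γ, ι γ • (x : 𝒢 ⧸ L) = (y : 𝒢 ⧸ L)) → x = y)
    (hcov : ∀ g : 𝒢, ∃ x ∈ s, ∃ γ : Γ, ι γ • (x : 𝒢 ⧸ L) = (g : 𝒢 ⧸ L)) (N₀ : ℕ) (q : ℕ)
    (hU : ∀ x ∈ s, ∀ z : groupCohomology (indStabilizerRep ι L σ x) q,
      ∃ i, ∃ y : groupCohomology (indStabilizerRep ι L (σst i) x) q,
        groupCohomology.map (MonoidHom.id _) (indStabMap ι L (σst i) σ x (φ i)) q y = N₀ • z)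
    (z : groupCohomology (indFun ι L σ) q) :
    ∃ i, ∃ y : groupCohomology (indFun ι L (σst i)) q,
      groupCohomology.map (MonoidHom.id Γ) (indFunMap ι L (σst i) σ (φ i)) q y = N₀ • z := by
  classical
  -- any projective resolution of `A` over `Γ` computes the (natural) orbit components
  let P : ProjectiveResolution (Rep.trivial A Γ A) := Rep.barResolution A Γ
  -- per orbit: index `i x` and preimage `y x` of the `x`-component of `N₀ • z`
  have hx : ∀ x ∈ s, ∃ i, ∃ y : groupCohomology (indStabilizerRep ι L (σst i) x) q,
      groupCohomology.map (MonoidHom.id _) (indStabMap ι L (σst i) σ x (φ i)) q y =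
        indToOrbitCohomologyNat ι L σ x P q (N₀ • z) := fun x hx => by
    obtain ⟨i, y, hy⟩ := hU x hx (indToOrbitCohomologyNat ι L σ x P q z)
    exact ⟨i, y, by rw [hy, map_nsmul]⟩
  choose i y hy using hx
  -- a common index `M ≥ i x`
  have hiM' : ∃ M, ∀ (x : 𝒢) (hx : x ∈ s), i x hx ≤ M := by
    obtain ⟨M, hM⟩ := Finset.exists_le (s.attach.image fun x : {x // x ∈ s} => i x.1 x.2)
    exact ⟨M, fun x hx => hM _ (Finset.mem_image.2 ⟨⟨x, hx⟩, Finset.mem_attach _ _, rfl⟩)⟩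
  obtain ⟨M, hiM⟩ := hiM'
  -- transport the preimages to the stage `M`
  let w : ∀ x : s, groupCohomology (indStabilizerRep ι L (σst M) x.1) q := fun x =>
    groupCohomology.map (MonoidHom.id _)
      (indStabMap ι L (σst (i x.1 x.2)) (σst M) x.1 (t (hiM x.1 x.2))) q (y x.1 x.2)
  have hw : ∀ x : s, groupCohomology.map (MonoidHom.id _) (indStabMap ι L (σst M) σ x.1 (φ M)) q (w x) =
      indToOrbitCohomologyNat ι L σ x.1 P q (N₀ • z) := fun x => by
    change (groupCohomology.map (MonoidHom.id _)
        (indStabMap ι L (σst (i x.1 x.2)) (σst M) x.1 (t (hiM x.1 x.2))) q ≫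
      groupCohomology.map (MonoidHom.id _) (indStabMap ι L (σst M) σ x.1 (φ M)) q) (y x.1 x.2) = _
    rw [← groupCohomology.map_id_comp]
    have hcomp : indStabMap ι L (σst (i x.1 x.2)) (σst M) x.1 (t (hiM x.1 x.2)) ≫
        indStabMap ι L (σst M) σ x.1 (φ M) = indStabMap ι L (σst (i x.1 x.2)) σ x.1 (φ (i x.1 x.2)) :=
      Rep.hom_ext (Representation.IntertwiningMap.ext (LinearMap.ext fun v => ht (hiM x.1 x.2) v))
    rw [hcomp]
    exact hy x.1 x.2
  -- glue at the stage `M` and compare components in `σ`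
  obtain ⟨Y, hY⟩ := (indToOrbitCohomologyNat_pi_bijective ι L (σst M) P s hdisj hcov q).2 w
  refine ⟨M, Y, (indToOrbitCohomologyNat_pi_bijective ι L σ P s hdisj hcov q).1 (funext fun x => ?_)⟩
  simp only
  rw [indToOrbitCohomologyNat_map_indFunMap, ← hw x]
  congr 1
  exact congr_fun hY x

include ht in
/-- The same with one multiple `N_x` per orbit: the conclusion holds with `N₀ = ∏_{x ∈ s} N_x`.
[cite: Scholze2015, §V.4 (proof of Thm. V.4.1)] [cite: Brown1982CohomologyGroups, III (6.2), (9.5)] -/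
theorem exists_map_indFunMap_eq_prod_nsmul_of_orbits (s : Finset 𝒢)
    (hdisj : ∀ x ∈ s, ∀ y ∈ s, (∃ γ : Γ, ι γ • (x : 𝒢 ⧸ L) = (y : 𝒢 ⧸ L)) → x = y)
    (hcov : ∀ g : 𝒢, ∃ x ∈ s, ∃ γ : Γ, ι γ • (x : 𝒢 ⧸ L) = (g : 𝒢 ⧸ L)) (Nx : 𝒢 → ℕ) (q : ℕ)
    (hU : ∀ x ∈ s, ∀ z : groupCohomology (indStabilizerRep ι L σ x) q,
      ∃ i, ∃ y : groupCohomology (indStabilizerRep ι L (σst i) x) q,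
        groupCohomology.map (MonoidHom.id _) (indStabMap ι L (σst i) σ x (φ i)) q y = Nx x • z)
    (z : groupCohomology (indFun ι L σ) q) :
    ∃ i, ∃ y : groupCohomology (indFun ι L (σst i)) q,
      groupCohomology.map (MonoidHom.id Γ) (indFunMap ι L (σst i) σ (φ i)) q y = (∏ x ∈ s, Nx x) • z := by
  classical
  refine exists_map_indFunMap_eq_nsmul_of_orbits ι L σ σst φ t ht s hdisj hcov (∏ x ∈ s, Nx x) q
    (fun x hx z' => ?_) z
  obtain ⟨i, y, hy⟩ := hU x hx z'
  refine ⟨i, (∏ x' ∈ s.erase x, Nx x') • y, ?_⟩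
  rw [map_nsmul, hy, ← mul_smul, Finset.prod_erase_mul s Nx hx]

end TwistedQuotient

end Literature.NumberTheory.Automorphic
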